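import Summits.ValiantsHypothesis.ValiantsHypothesis.Theses.DivisionGap
import Literature.Barriers.ValiantsHypothesis.MonotoneGapPermanentProofs
import Literature.Computability.AlgebraicComplexity.ArithCircuitProofs

/-!
# `DivisionGap.PerDivisionHard` (stmt-ValiantsHypothesis-5065): the bridge from the tree's weighted
`complexity` over `ℝ≥0` to Jerrum–Snir's plain `⊗`-count, and the constant-multiplier rung

The crux measures monotone pairs `(per_n · h, h)` with `complexity` over `ℝ≥0` (fan-in-two circuits
with WEIGHTED sum gates `c • u + d • v`), while the tree's Jerrum–Snir lower bound
`JerrumSnir1982_permanent_holds` is stated for PLAIN circuits (`IsMonotoneComputation`: all sum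
coefficients `1`) and counts product gates (`prodCount`).  The grounder and the route reviewer both
flagged the missing bridge.  Here it is, for every commutative semiring (no new definitions in the
statements; the construction `Plainify.*` is internal):

* `exists_plain_of_computes` — a fan-in-two circuit of size `s` computing `f` yields a PLAIN fan-in-two
  circuit computing `f` with at most `2s` product gates (each weighted sum `c • u + d • v` becomes
  `(c ⊗ u) ⊕ (d ⊗ v)`: two products by constant inputs and one plain sum; references re-indexed
  `j ↦ 3j + 2`).
* `exists_isMonotoneComputation_prodCount_le` — hence over `ℝ≥0` some monotone computation of `f` has
  `prodCount ≤ 2 · complexity f`.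
* `js_le_two_mul_complexity_perPoly` — **`n (2^{n-1} - 1) ≤ 2 · L(per_n)`** for the crux's `L`
  (Jerrum–Snir 1982 §4.3 through the bridge).
* `pair_const_lower_bound` — the rung "`h` a nonzero constant" of the crux in closed form:
  `n (2^{n-1} - 1) ≤ 2 · (L(per_n · C a) + L(C a)) + 2` for `a ≠ 0` — exponential, so no
  counterexample to `PerDivisionHard` has constant `h` (the comparison `2^{(log n + c)^c} = o(2^n)` is
  left informal).

Standing-disprover output (cdisprove seat); neutral helper lemmas, no route statement asserted.
-/

noncomputable section

namespace Summit.ValiantsHypothesis.Theorems.PerDivisionHardNegative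

open Literature.Computability.AlgebraicComplexity Literature.Barriers.ValiantsHypothesis MvPolynomial
open ArithCircuit (Gate Operand gateValues gateValues_append_singleton gateValues_length)
open scoped NNReal

namespace Plainify

variable {k : Type} [CommSemiring k] {σ : Type}

/-! ### The construction -/

/-- Re-index gate references `j ↦ 3j + 2` (the value of old gate `j` sits at new position `3j + 2`).
[folklore] -/
def op : Operand k σ → Operand k σ
  | .var i => .var i
  | .const c => .const c
  | .gate j => .gate (3 * j + 2)

/-- The three plain gates replacing old gate number `i`; the third carries the old value.
[cite: JerrumSnir1982, §2.2] -/
def triple (i : ℕ) : Gate k σ → List (Gate k σ)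
  | .prod args => [.sum [], .sum [], .prod (args.map op)]
  | .sum [] => [.sum [], .sum [], .sum []]
  | .sum [(c, u)] => [.prod [.const c, op u], .sum [], .sum [(1, .gate (3 * i))]]
  | .sum [(c, u), (d, v)] =>
      [.prod [.const c, op u], .prod [.const d, op v], .sum [(1, .gate (3 * i)), (1, .gate (3 * i + 1))]]
  | .sum (_ :: _ :: _ :: _) => [.sum [], .sum [], .sum []]

/-- The new gate list, old gate `i` expanded in place. [folklore] -/
def gatesAux : ℕ → List (Gate k σ) → List (Gate k σ)
  | _, [] => []
  | i, g :: gs => triple i g ++ gatesAux (i + 1) gs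

/-- The plain circuit. [folklore] -/
def circuit (P : ArithCircuit k σ) : ArithCircuit k σ where
  gates := gatesAux 0 P.gates
  output := op P.output

/-! ### Bookkeeping -/

/-- Each old gate becomes exactly three new gates. [folklore] -/
theorem length_triple (i : ℕ) (g : Gate k σ) : (triple i g).length = 3 := by
  cases g with
  | prod args => rfl
  | sum args =>
    rcases args with _ | ⟨⟨c, u⟩, _ | ⟨⟨d, v⟩, _ | ⟨e, rest⟩⟩⟩ <;> rfl

/-- The expansion of a gate list with one more gate. [folklore] -/
theorem gatesAux_append (i : ℕ) (gs : List (Gate k σ)) (g : Gate k σ) :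
    gatesAux i (gs ++ [g]) = gatesAux i gs ++ triple (i + gs.length) g := by
  induction gs generalizing i with
  | nil => simp [gatesAux]
  | cons g' gs ih =>
    simp only [List.cons_append, gatesAux, ih (i + 1), List.append_assoc, List.length_cons]
    rw [show i + (gs.length + 1) = i + 1 + gs.length by omega]

/-- The new gate list is three times as long. [folklore] -/
theorem length_gatesAux (i : ℕ) (gs : List (Gate k σ)) : (gatesAux i gs).length = 3 * gs.length := by
  induction gs generalizing i with
  | nil => rfl
  | cons g gs ih => simp [gatesAux, ih, length_triple]; ring

/-- Every new gate comes from the triple of some old gate. [folklore] -/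
theorem mem_gatesAux {i : ℕ} {gs : List (Gate k σ)} {g' : Gate k σ} (h : g' ∈ gatesAux i gs) :
    ∃ j g, g ∈ gs ∧ g' ∈ triple j g := by
  induction gs generalizing i with
  | nil => simp [gatesAux] at h
  | cons g gs ih =>
    simp only [gatesAux, List.mem_append] at h
    rcases h with h | h
    · exact ⟨i, g, List.mem_cons_self, h⟩
    · obtain ⟨j, g₀, hg₀, hj⟩ := ih h
      exact ⟨j, g₀, List.mem_cons_of_mem _ hg₀, hj⟩

/-- Every new gate is plain. [cite: JerrumSnir1982, §2.2] -/
theorem isPlainGate_of_mem_triple {i : ℕ} {g g' : Gate k σ} (h : g' ∈ triple i g) : IsPlainGate g' := by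
  cases g with
  | prod args => simp [triple] at h; rcases h with rfl | rfl | rfl <;> simp [IsPlainGate]
  | sum args =>
    rcases args with _ | ⟨⟨c, u⟩, _ | ⟨⟨d, v⟩, _ | ⟨e, rest⟩⟩⟩ <;> simp [triple] at h <;>
      rcases h with rfl | rfl | rfl <;> simp [IsPlainGate]

/-- Fan-in two is preserved. [folklore] -/
theorem fanIn_of_mem_triple {i : ℕ} {g g' : Gate k σ} (hg : g.fanIn ≤ 2) (h : g' ∈ triple i g) :
    g'.fanIn ≤ 2 := by
  cases g with
  | prod args =>
    simp [triple] at h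
    rcases h with rfl | rfl | rfl <;> simp_all [Gate.fanIn, Gate.args]
  | sum args =>
    rcases args with _ | ⟨⟨c, u⟩, _ | ⟨⟨d, v⟩, _ | ⟨e, rest⟩⟩⟩ <;> simp [triple] at h <;>
      rcases h with rfl | rfl | rfl <;> simp [Gate.fanIn, Gate.args]

/-- At most two product gates per old gate. [folklore] -/
theorem countP_triple_le (i : ℕ) (g : Gate k σ) : (triple i g).countP (fun g => isProdGate g) ≤ 2 := by
  cases g with
  | prod args => simp [triple, isProdGate]
  | sum args =>
    rcases args with _ | ⟨⟨c, u⟩, _ | ⟨⟨d, v⟩, _ | ⟨e, rest⟩⟩⟩ <;> simp [triple, isProdGate]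

/-- The new gate list has at most `2 ·` (old size) product gates. [folklore] -/
theorem countP_gatesAux_le (i : ℕ) (gs : List (Gate k σ)) :
    (gatesAux i gs).countP (fun g => isProdGate g) ≤ 2 * gs.length := by
  induction gs generalizing i with
  | nil => simp [gatesAux]
  | cons g gs ih =>
    simp only [gatesAux, List.countP_append, List.length_cons]
    have := countP_triple_le (k := k) i g
    have := ih (i + 1)
    omega

/-! ### Semantics -/

/-! `vals` and `w` *agree* when the value of old gate `j` is found at new position `3j + 2` of `w`
(junk beyond): `∀ j, w.getD (3 * j + 2) 0 = vals.getD j 0`.  Kept inline (no definition). -/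

/-- Re-indexed operands read the old values from an agreeing value list. [folklore] -/
theorem eval_op {vals w : List (MvPolynomial σ k)} (hA : ∀ j, w.getD (3 * j + 2) 0 = vals.getD j 0) (u : Operand k σ) :
    (op u).eval w = u.eval vals := by
  cases u with
  | var i => rfl
  | const c => rfl
  | gate j => simp only [op, Operand.eval]; exact hA j

/-- Appending at most two junk-inaccessible values keeps the agreement. [folklore] -/
theorem agree_append {vals w : List (MvPolynomial σ k)} (hA : ∀ j, w.getD (3 * j + 2) 0 = vals.getD j 0)
    (hw : w.length = 3 * vals.length) (L : List (MvPolynomial σ k)) (hL : L.length ≤ 2) :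
    ∀ j, (w ++ L).getD (3 * j + 2) 0 = vals.getD j 0 := by
  intro j
  by_cases hj : 3 * j + 2 < w.length
  · rw [List.getD_eq_getElem?_getD, List.getElem?_append_left hj, ← List.getD_eq_getElem?_getD]
    exact hA j
  · have hj' : vals.length ≤ j := by omega
    rw [List.getD_eq_getElem?_getD, List.getD_eq_getElem?_getD,
      List.getElem?_eq_none_iff.2 (by simp; omega), List.getElem?_eq_none_iff.2 hj']

/-- Three steps of the fold defining `gateValues`. [folklore] -/
theorem gateValues_append_three (G : List (Gate k σ)) (a b c : Gate k σ) :
    gateValues (G ++ [a, b, c]) =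
      gateValues G ++ [a.eval (gateValues G), b.eval (gateValues G ++ [a.eval (gateValues G)]),
        c.eval (gateValues G ++ [a.eval (gateValues G),
          b.eval (gateValues G ++ [a.eval (gateValues G)])])] := by
  have : G ++ [a, b, c] = G ++ [a] ++ [b] ++ [c] := by simp
  rw [this, gateValues_append_singleton, gateValues_append_singleton, gateValues_append_singleton]
  simp

/-- Reading the two freshly appended values. [folklore] -/
theorem getD_append_two_fst (w : List (MvPolynomial σ k)) (x y : MvPolynomial σ k) :
    (w ++ [x, y]).getD w.length 0 = x := by
  rw [List.getD_eq_getElem?_getD, List.getElem?_append_right le_rfl]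
  simp

/-- Reading the second of two freshly appended values. [folklore] -/
theorem getD_append_two_snd (w : List (MvPolynomial σ k)) (x y : MvPolynomial σ k) :
    (w ++ [x, y]).getD (w.length + 1) 0 = y := by
  rw [List.getD_eq_getElem?_getD, List.getElem?_append_right (Nat.le_succ _)]
  simp

/-- Value of a binary product gate. [folklore] -/
theorem eval_prod_two (w : List (MvPolynomial σ k)) (x y : Operand k σ) :
    (Gate.prod [x, y]).eval w = x.eval w * y.eval w := by
  simp [Gate.eval]

/-- Value of the empty sum gate. [folklore] -/
theorem eval_sum_nil (w : List (MvPolynomial σ k)) :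
    (Gate.sum ([] : List (k × Operand k σ))).eval w = 0 := by
  simp [Gate.eval]

/-- Value of a unary weighted sum gate. [folklore] -/
theorem eval_sum_one (w : List (MvPolynomial σ k)) (c : k) (x : Operand k σ) :
    (Gate.sum [(c, x)]).eval w = c • x.eval w := by
  simp [Gate.eval]

/-- Value of a binary weighted sum gate. [folklore] -/
theorem eval_sum_two (w : List (MvPolynomial σ k)) (c d : k) (x y : Operand k σ) :
    (Gate.sum [(c, x), (d, y)]).eval w = c • x.eval w + d • y.eval w := by
  simp [Gate.eval]

/-- Value of a constant operand. [folklore] -/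
theorem eval_const (w : List (MvPolynomial σ k)) (c : k) :
    (Operand.const c : Operand k σ).eval w = C c := rfl

/-- **The new circuit carries the old gate values at positions `3j + 2`.** [folklore] -/
theorem agree_gateValues (gs : List (Gate k σ)) (h2 : ∀ g ∈ gs, g.fanIn ≤ 2) :
    ∀ j, (gateValues (gatesAux 0 gs)).getD (3 * j + 2) 0 = (gateValues gs).getD j 0 := by
  induction gs using List.reverseRecOn with
  | nil =>
    intro j
    simp [gatesAux, gateValues]
  | append_singleton gs g ih =>
    have h2' : ∀ g' ∈ gs, g'.fanIn ≤ 2 := fun g' hg' => h2 g' (List.mem_append_left _ hg')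
    have hg : g.fanIn ≤ 2 := h2 g (by simp)
    have hA := ih h2'
    set vals := gateValues gs with hvals
    set w := gateValues (gatesAux 0 gs) with hw
    have hwlen : w.length = 3 * vals.length := by
      rw [hw, hvals, gateValues_length, gateValues_length, length_gatesAux]
    rw [gatesAux_append, Nat.zero_add]
    -- the appended value list has the form `w ++ [va, vb, vc]`; it suffices to know `vc`
    suffices key : ∃ va vb, gateValues (gatesAux 0 gs ++ triple gs.length g) =
        w ++ [va, vb, g.eval vals] by
      obtain ⟨va, vb, hkey⟩ := key
      rw [hkey, gateValues_append_singleton, ← hvals]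
      intro j
      rcases Nat.lt_trichotomy j vals.length with hj | rfl | hj
      · rw [List.getD_eq_getElem?_getD, List.getElem?_append_left (by omega),
          List.getD_eq_getElem?_getD, List.getElem?_append_left hj, ← List.getD_eq_getElem?_getD,
          ← List.getD_eq_getElem?_getD]
        exact hA j
      · rw [List.getD_eq_getElem?_getD, List.getElem?_append_right (by omega),
          List.getD_eq_getElem?_getD, List.getElem?_append_right le_rfl]
        simp [hwlen]
      · rw [List.getD_eq_getElem?_getD, List.getD_eq_getElem?_getD,
          List.getElem?_eq_none_iff.2 (by simp; omega), List.getElem?_eq_none_iff.2 (by simp; omega)]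
    -- agreement persists while the first two new gates are appended
    have hA1 : ∀ x : MvPolynomial σ k, ∀ j, (w ++ [x]).getD (3 * j + 2) 0 = vals.getD j 0 := fun x =>
      agree_append hA hwlen [x] (by simp)
    have hA2 : ∀ x y : MvPolynomial σ k, ∀ j, (w ++ [x, y]).getD (3 * j + 2) 0 = vals.getD j 0 := fun x y =>
      agree_append hA hwlen [x, y] (by simp)
    have h3 : 3 * gs.length = w.length := by rw [hwlen, hvals, gateValues_length]
    cases g with
    | prod args =>
      refine ⟨0, 0, ?_⟩
      rw [show triple gs.length (Gate.prod args) = [.sum [], .sum [], .prod (args.map op)] from rfl,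
        gateValues_append_three, ← hw]
      simp only [eval_sum_nil]
      congr 1
      simp only [List.cons.injEq, true_and, and_true]
      simp only [Gate.eval, List.map_map]
      congr 1
      exact List.map_congr_left fun u _ => eval_op (hA2 0 0) u
    | sum args =>
      rcases args with _ | ⟨⟨c, u⟩, _ | ⟨⟨d, v⟩, _ | ⟨e, rest⟩⟩⟩
      · -- empty sum
        refine ⟨0, 0, ?_⟩
        rw [show triple gs.length (Gate.sum ([] : List (k × Operand k σ))) =
            [.sum [], .sum [], .sum []] from rfl, gateValues_append_three, ← hw]
        simp only [eval_sum_nil]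
      · -- one summand `c • u`
        refine ⟨C c * u.eval vals, 0, ?_⟩
        rw [show triple gs.length (Gate.sum [(c, u)]) =
            [.prod [.const c, op u], .sum [], .sum [(1, .gate (3 * gs.length))]] from rfl,
          gateValues_append_three, ← hw]
        have e0 : (Gate.prod [.const c, op u]).eval w = C c * u.eval vals := by
          rw [eval_prod_two, eval_op hA, eval_const]
        rw [e0]
        simp only [eval_sum_nil]
        have e2 : (Gate.sum [((1 : k), Operand.gate (3 * gs.length))]).eval (w ++ [C c * u.eval vals, 0]) =
            C c * u.eval vals := by
          rw [eval_sum_one, one_smul, ArithCircuit.Operand.eval_gate, h3, getD_append_two_fst]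
        rw [e2, eval_sum_one, smul_eq_C_mul]
      · -- two summands `c • u + d • v`
        refine ⟨C c * u.eval vals, C d * v.eval vals, ?_⟩
        rw [show triple gs.length (Gate.sum [(c, u), (d, v)]) =
            [.prod [.const c, op u], .prod [.const d, op v],
              .sum [(1, .gate (3 * gs.length)), (1, .gate (3 * gs.length + 1))]] from rfl,
          gateValues_append_three, ← hw]
        have e0 : (Gate.prod [.const c, op u]).eval w = C c * u.eval vals := by
          rw [eval_prod_two, eval_op hA, eval_const]
        rw [e0]
        have e1 : (Gate.prod [.const d, op v]).eval (w ++ [C c * u.eval vals]) = C d * v.eval vals := by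
          rw [eval_prod_two, eval_op (hA1 _), eval_const]
        rw [e1]
        have e2 : (Gate.sum [((1 : k), Operand.gate (3 * gs.length)), (1, .gate (3 * gs.length + 1))]).eval
            (w ++ [C c * u.eval vals, C d * v.eval vals]) = C c * u.eval vals + C d * v.eval vals := by
          rw [eval_sum_two, one_smul, one_smul, ArithCircuit.Operand.eval_gate, ArithCircuit.Operand.eval_gate, h3, getD_append_two_fst,
            getD_append_two_snd]
        rw [e2, eval_sum_two, smul_eq_C_mul, smul_eq_C_mul]
      · -- three or more summands: excluded by fan-in two
        exfalso
        simp [Gate.fanIn, Gate.args] at hg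

/-- The plain circuit computes the same polynomial. [folklore] -/
theorem computes {P : ArithCircuit k σ} {f : MvPolynomial σ k} (h2 : P.IsFanInTwo) (hf : P.Computes f) :
    (circuit P).Computes f := by
  unfold ArithCircuit.Computes at hf ⊢
  rw [← hf]
  exact eval_op (agree_gateValues P.gates h2) P.output

end Plainify

/-! ### The bridge and the constant-multiplier rung -/

section Bridge

variable {k : Type} [CommSemiring k] {σ : Type}

/-- **Weighted fan-in-two circuits are plain circuits with at most twice as many product gates.**
[cite: JerrumSnir1982, §2.2] -/
theorem exists_plain_of_computes {P : ArithCircuit k σ} {f : MvPolynomial σ k} (h2 : P.IsFanInTwo)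
    (hf : P.Computes f) :
    ∃ Q : ArithCircuit k σ, Q.IsFanInTwo ∧ IsPlain Q ∧ Q.Computes f ∧ prodCount Q ≤ 2 * P.size := by
  refine ⟨Plainify.circuit P, ?_, ?_, Plainify.computes h2 hf, ?_⟩
  · intro g' hg'
    have hg'' : g' ∈ Plainify.gatesAux 0 P.gates := hg'
    obtain ⟨j, g, hg, hj⟩ := Plainify.mem_gatesAux hg''
    exact Plainify.fanIn_of_mem_triple (h2 g hg) hj
  · intro g' hg'
    have hg'' : g' ∈ Plainify.gatesAux 0 P.gates := hg'
    obtain ⟨j, g, -, hj⟩ := Plainify.mem_gatesAux hg''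
    exact Plainify.isPlainGate_of_mem_triple hj
  · exact Plainify.countP_gatesAux_le 0 P.gates

/-- Over `ℝ≥0`: some monotone computation of `f` has `⊗`-count at most `2 · complexity f`.
[cite: JerrumSnir1982, §2.2] -/
theorem exists_isMonotoneComputation_prodCount_le (f : MvPolynomial σ ℝ≥0) :
    ∃ Q : ArithCircuit ℝ≥0 σ, IsMonotoneComputation Q f ∧ prodCount Q ≤ 2 * complexity f := by
  obtain ⟨P, h2, hf, hs⟩ := ArithCircuit.exists_computes_size_eq_complexity f
  obtain ⟨Q, hQ2, hQp, hQf, hQc⟩ := exists_plain_of_computes h2 hf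
  exact ⟨Q, ⟨hQ2, hQp, hQf⟩, hs ▸ hQc⟩

end Bridge

section Permanent

variable {n : ℕ}

/-- **Jerrum–Snir for the crux's measure: `n (2^{n-1} - 1) ≤ 2 · L(per_n)` over `ℝ≥0`.**
[cite: JerrumSnir1982, §4.3] -/
theorem js_le_two_mul_complexity_perPoly (hn : 1 ≤ n) :
    n * (2 ^ (n - 1) - 1) ≤ 2 * complexity (perPoly (Fin n) ℝ≥0) := by
  obtain ⟨Q, hQ, hc⟩ := exists_isMonotoneComputation_prodCount_le (perPoly (Fin n) ℝ≥0)
  exact ((JerrumSnir1982_permanent_holds n hn).1 Q hQ).trans hc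

/-- **The constant-multiplier rung of the crux, in closed form.** For `a ≠ 0` the pair
`(per_n · C a, C a)` costs at least `n (2^{n-1} - 1) / 2 - 1`: scaling back by `a⁻¹` is one gate.
So no counterexample to `PerDivisionHard` has a constant `h`. [cite: JerrumSnir1982, §4.3] -/
theorem pair_const_lower_bound (hn : 1 ≤ n) {a : ℝ≥0} (ha : a ≠ 0) :
    n * (2 ^ (n - 1) - 1) ≤
      2 * (complexity (perPoly (Fin n) ℝ≥0 * C a) + complexity (C a : MvPolynomial (Fin n × Fin n) ℝ≥0))
        + 2 := by
  have hC : complexity (C a : MvPolynomial (Fin n × Fin n) ℝ≥0) = 0 := complexity_C_holds a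
  have hsmul : perPoly (Fin n) ℝ≥0 * C a = a • perPoly (Fin n) ℝ≥0 := by
    rw [mul_comm, smul_eq_C_mul]
  have hback : complexity (perPoly (Fin n) ℝ≥0) ≤ complexity (a • perPoly (Fin n) ℝ≥0) + 1 := by
    have h := complexity_smul_le_holds a⁻¹ (a • perPoly (Fin n) ℝ≥0)
    rwa [inv_smul_smul₀ ha] at h
  have hjs := js_le_two_mul_complexity_perPoly hn
  rw [hC, hsmul]
  omega

end Permanent

end Summit.ValiantsHypothesis.Theorems.PerDivisionHardNegative

end
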